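import Literature.LinearAlgebra.Matrix.PolarOrthonormalization
import HarnessLib

/-!
# The exponential of a frame-conjugated matrix `K D Kᴴ`: exact formula for an isometric frame and a
# two-sided Loewner enclosure for a nearly orthonormal frame

Topic `LinearAlgebra/Matrix`; namespace `Literature.LinearAlgebra.Matrix.FrameExponential`. Everything is
PROVED; no definition, no named fact. Scalars `RCLike 𝕜`; norms are the `ℓ²`-operator norms
(`open scoped Matrix.Norms.L2Operator`), Loewner order `open scoped MatrixOrder`; `exp` is Mathlib's
`NormedSpace.exp` (= `cfc Real.exp` on Hermitian matrices, `CFC.real_exp_eq_normedSpace_exp`).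

Let `K ∈ 𝕜^{m×n}` (a FRAME of `n` column vectors in `𝕜^m`), `D ∈ 𝕜^{n×n}`, `P := Kᴴ K` (the Gram matrix).

* §1 `(K D Kᴴ)^{j+1} = K ((D P)^j D) Kᴴ`; for an isometric frame (`Kᴴ K = 1`) `(K D Kᴴ)^{j+1} = K D^{j+1} Kᴴ`.
* §2 EXACT ISOMETRY: `exp (K D Kᴴ) = 1 + K (exp D − 1) Kᴴ` (`exp_frameConj_of_isometry`; the exponential
  series term by term), and with a scalar shift `exp (c·1 + K D Kᴴ) = e^c · (1 + K (exp D − 1) Kᴴ)`.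
* §3 NEARLY ORTHONORMAL FRAME: if `‖Kᴴ K − 1‖ ≤ ε` (`ε ≥ 0`) and `‖D‖ ≤ α`, then
  `‖exp (K D Kᴴ) − 1 − K (exp D − 1) Kᴴ‖ ≤ θ(α, ε) := e^{(1+ε)α} − (1+ε) e^{α} + ε`
  (`norm_exp_frameConj_sub_le`; `θ(α,0) = 0`, `θ ≈ ε(α e^α − e^α + 1)` for small `ε`). Proof: termwise,
  `‖(D P)^j D − D^{j+1}‖ ≤ α(((1+ε)α)^j − α^j)` (`norm_pow_mul_sub_pow_le`) and `‖K‖² = ‖P‖ ≤ 1 + ε`, summed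
  against the two real exponential series.
* The LOEWNER form (Hermitian data `D = diag(a)`, two-sided `≤` enclosures of `exp(−G)` for
  `G = ḡ·1 + K diag(g − ḡ) Kᴴ`, the `cfc Real.exp` version over `ℂ`, and the exact-arithmetic interface
  `Σ|E_ij|² ≤ ε² ⟹ ‖E‖ ≤ ε`) is the sequel `FrameConjugatedExponentialLoewner.lean`.

Motivation (not formalised): a numerically produced eigen-decomposition `X ≈ K diag(λ) Kᵀ` stored in dyadic
rationals is only NEARLY orthonormal; §3 turns it into a certified enclosure of `e^{−X}` using integer matrix
products only (`ε² ≥ ‖KᵀK − 1‖_F² ≥ ‖KᵀK − 1‖²` is checkable in exact arithmetic), with no polar factor and no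
Duhamel formula. The constant `θ` improves the constant `e^{α}[κe^{κ} + (2ε + ε²)(1 + ε)]`, `κ = εα(2 + ε/2)`,
of the polar-factor argument.

## Mathlib / tree search

REUSED: `NormedSpace.exp_series_hasSum_exp'`, `NormedSpace.algebraMap_exp_comm`, `Matrix.exp_add_of_commute`,
`Matrix.exp_diagonal`, `Matrix.l2_opNorm_mul`, `Matrix.l2_opNorm_conjTranspose(_mul_self)`,
`NormedSpace.expSeries_div_hasSum_exp`, `HasSum.norm_le_of_bounded`, `hasSum_ite_eq` (Mathlib).
Nothing on `exp (K * D * Kᴴ)` for non-square `K` in Mathlib or the tree (`lean search 'exp.*conjTranspose|frame'`);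
`PolarOrthonormalization.lean` (tree) has the polar ISOMETRY of a nearly orthonormal frame, not its exponential.

## References

* N. J. Higham, *Functions of Matrices* (SIAM 2008), Thm. 1.13 (f(A) for `A = Z diag Z⁻¹`), §10.1
  (Taylor series of the exponential, remainder bounds), Problem 1.33 (`f(αI + A)`). [cite: Higham2008, Thm. 1.13, §10.1]
* R. A. Horn, C. R. Johnson, *Matrix Analysis*, 2nd ed. (2013), §5.6 (submultiplicative norms, `ρ(A) ≤ ‖A‖`),
  §7.7 (Loewner order). [cite: HornJohnson2013, Thm. 5.6.9, §7.7]
-/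

noncomputable section

open scoped Matrix.Norms.L2Operator MatrixOrder ComplexOrder
open NormedSpace Matrix
open scoped Nat

namespace Literature.LinearAlgebra.Matrix

namespace FrameExponential

variable {𝕜 : Type*} [RCLike 𝕜] {m n : Type*} [Fintype m] [Fintype n] [DecidableEq m] [DecidableEq n]

/-! ### §1 Powers of a frame-conjugated matrix -/

/-- `(K D Kᴴ)^{j+1} = K ((D·KᴴK)^j D) Kᴴ`. [cite: Higham2008, Thm. 1.13] -/
theorem frameConj_pow_succ (K : Matrix m n 𝕜) (D : Matrix n n 𝕜) (j : ℕ) :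
    (K * D * Kᴴ) ^ (j + 1) = K * ((D * (Kᴴ * K)) ^ j * D) * Kᴴ := by
  induction j with
  | zero => simp [Matrix.mul_assoc]
  | succ j ih =>
    rw [pow_succ, ih, pow_succ]
    simp only [Matrix.mul_assoc]

/-- For an ISOMETRIC frame (`Kᴴ K = 1`): `(K D Kᴴ)^{j+1} = K D^{j+1} Kᴴ`. [cite: Higham2008, Thm. 1.13] -/
theorem frameConj_pow_succ_of_isometry {K : Matrix m n 𝕜} (hK : Kᴴ * K = 1) (D : Matrix n n 𝕜) (j : ℕ) :
    (K * D * Kᴴ) ^ (j + 1) = K * D ^ (j + 1) * Kᴴ := by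
  rw [frameConj_pow_succ, hK, Matrix.mul_one, ← pow_succ]

/-! ### §2 The exponential of `K D Kᴴ` for an isometric frame -/

omit [Fintype m] [DecidableEq m] [DecidableEq n] in
/-- Conjugation by a frame maps convergent series to convergent series: `Σ K f_j Kᴴ = K (Σ f_j) Kᴴ` (continuity of
matrix multiplication). [cite: HornJohnson2013, §5.6] -/
theorem hasSum_frameConj {ι : Type*} {f : ι → Matrix n n 𝕜} {S : Matrix n n 𝕜} (h : HasSum f S)
    (K : Matrix m n 𝕜) : HasSum (fun j => K * f j * Kᴴ) (K * S * Kᴴ) := by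
  let Φ : Matrix n n 𝕜 →+ Matrix m m 𝕜 :=
    { toFun := fun X => K * X * Kᴴ
      map_zero' := by simp
      map_add' := fun X Y => by simp [Matrix.mul_add, Matrix.add_mul] }
  have hΦ : Continuous Φ := (continuous_const.matrix_mul continuous_id).matrix_mul continuous_const
  exact h.map Φ hΦ

/-- **Exponential of an isometrically conjugated matrix.** If `Kᴴ K = 1` (`K ∈ 𝕜^{m×n}` has orthonormal
columns) then `exp (K D Kᴴ) = 1 + K (exp D − 1) Kᴴ` for every `D ∈ 𝕜^{n×n}`: on `range K` the matrix acts as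
`D`, on its orthogonal complement as `0`. [cite: Higham2008, Thm. 1.13] -/
theorem exp_frameConj_of_isometry {K : Matrix m n 𝕜} (hK : Kᴴ * K = 1) (D : Matrix n n 𝕜) :
    exp (K * D * Kᴴ) = 1 + K * (exp D - 1) * Kᴴ := by
  have h1 : HasSum (fun j : ℕ => ((j ! : 𝕜)⁻¹) • (K * D * Kᴴ) ^ j) (exp (K * D * Kᴴ)) :=
    exp_series_hasSum_exp' _
  have h3 : HasSum (fun j : ℕ => K * (((j ! : 𝕜)⁻¹) • D ^ j) * Kᴴ) (K * exp D * Kᴴ) :=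
    hasSum_frameConj (exp_series_hasSum_exp' D) K
  have h4 : HasSum (fun j : ℕ => ((j ! : 𝕜)⁻¹) • (K * D * Kᴴ) ^ j - K * (((j ! : 𝕜)⁻¹) • D ^ j) * Kᴴ)
      (1 - K * Kᴴ) := by
    have e : (fun j : ℕ => ((j ! : 𝕜)⁻¹) • (K * D * Kᴴ) ^ j - K * (((j ! : 𝕜)⁻¹) • D ^ j) * Kᴴ) =
        fun j => if j = 0 then 1 - K * Kᴴ else 0 := by
      funext j
      cases j with
      | zero => simp
      | succ j =>
        rw [if_neg (Nat.succ_ne_zero j), frameConj_pow_succ_of_isometry hK, Matrix.mul_smul,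
          Matrix.smul_mul]
        exact sub_self _
    rw [e]
    exact hasSum_ite_eq 0 _
  have h5 := (h1.sub h3).unique h4
  rw [sub_eq_iff_eq_add] at h5
  rw [h5, Matrix.mul_sub, Matrix.sub_mul, Matrix.mul_one]
  abel

/-- `exp (c·1) = e^c · 1`. [cite: Higham2008, Problem 1.33] -/
theorem exp_smul_one (c : 𝕜) : exp (c • (1 : Matrix m m 𝕜)) = exp c • (1 : Matrix m m 𝕜) := by
  rw [← Algebra.algebraMap_eq_smul_one, ← algebraMap_exp_comm, Algebra.algebraMap_eq_smul_one]

/-- A scalar shift factors out of the exponential: `exp (c·1 + M) = e^c · exp M`. [cite: Higham2008, Problem 1.33] -/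
theorem exp_smul_one_add (c : 𝕜) (M : Matrix m m 𝕜) :
    exp (c • (1 : Matrix m m 𝕜) + M) = exp c • exp M := by
  rw [Matrix.exp_add_of_commute _ _ ((Commute.one_left M).smul_left c), exp_smul_one, smul_mul_assoc,
    Matrix.one_mul]

/-- **Isometric frame with a scalar shift**: `Kᴴ K = 1` ⟹ `exp (c·1 + K D Kᴴ) = e^c · (1 + K (exp D − 1) Kᴴ)`.
[cite: Higham2008, Thm. 1.13] -/
theorem exp_smul_one_add_frameConj_of_isometry {K : Matrix m n 𝕜} (hK : Kᴴ * K = 1) (c : 𝕜)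
    (D : Matrix n n 𝕜) : exp (c • (1 : Matrix m m 𝕜) + K * D * Kᴴ) = exp c • (1 + K * (exp D - 1) * Kᴴ) := by
  rw [exp_smul_one_add, exp_frameConj_of_isometry hK]

/-- **Diagonal data**: `Kᴴ K = 1` ⟹ `exp (K diag(a) Kᴴ) = 1 + K diag(e^{a_k} − 1) Kᴴ`. [cite: Higham2008, Thm. 1.13] -/
theorem exp_frameConj_diagonal_of_isometry {K : Matrix m n 𝕜} (hK : Kᴴ * K = 1) (a : n → 𝕜) :
    exp (K * diagonal a * Kᴴ) = 1 + K * diagonal (fun k => exp (a k) - 1) * Kᴴ := by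
  have e : exp (diagonal a) - 1 = diagonal (fun k => exp (a k) - 1) := by
    rw [Matrix.exp_diagonal, ← diagonal_one, diagonal_sub]
    congr 1
    funext k
    rw [Pi.coe_exp]
  rw [exp_frameConj_of_isometry hK, e]


/-! ### §3 Nearly orthonormal frames: the remainder bound -/

omit [Fintype m] [DecidableEq m] in
/-- `‖1‖ ≤ 1` for the `ℓ²`-operator norm (`= 1` unless the index type is empty). [cite: HornJohnson2013, §5.6] -/
theorem norm_one_le_one : ‖(1 : Matrix n n 𝕜)‖ ≤ 1 := by
  cases isEmpty_or_nonempty n with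
  | inl h => rw [Subsingleton.elim (1 : Matrix n n 𝕜) 0, norm_zero]; exact zero_le_one
  | inr h => exact le_of_eq norm_one

omit [Fintype m] [DecidableEq m] in
/-- `‖X^j‖ ≤ ‖X‖^j` (also for `j = 0`, by `‖1‖ ≤ 1`). [cite: HornJohnson2013, §5.6] -/
theorem norm_pow_le_pow_norm (X : Matrix n n 𝕜) : ∀ j : ℕ, ‖X ^ j‖ ≤ ‖X‖ ^ j
  | 0 => by rw [pow_zero, pow_zero]; exact norm_one_le_one
  | j + 1 => by
    rw [pow_succ, pow_succ]
    exact (norm_mul_le _ _).trans (mul_le_mul_of_nonneg_right (norm_pow_le_pow_norm X j) (norm_nonneg _))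

omit [Fintype m] [DecidableEq m] in
/-- A nearly-identity Gram matrix has norm at most `1 + ε`: `‖P − 1‖ ≤ ε ⟹ ‖P‖ ≤ 1 + ε`. [cite: HornJohnson2013, §5.6] -/
theorem norm_le_one_add_of_norm_sub_one_le {P : Matrix n n 𝕜} {ε : ℝ} (hP : ‖P - 1‖ ≤ ε) : ‖P‖ ≤ 1 + ε :=
  calc ‖P‖ = ‖(P - 1) + 1‖ := by rw [sub_add_cancel]
    _ ≤ ‖P - 1‖ + ‖(1 : Matrix n n 𝕜)‖ := norm_add_le _ _
    _ ≤ ε + 1 := add_le_add hP norm_one_le_one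
    _ = 1 + ε := add_comm _ _

/-- **Conjugation by a nearly orthonormal frame is nearly contractive**: `‖Kᴴ K − 1‖ ≤ ε ⟹ ‖K X Kᴴ‖ ≤ (1+ε)‖X‖`
(`‖K‖² = ‖Kᴴ K‖`, the C⋆-identity for the operator norm). [cite: HornJohnson2013, §5.6] -/
theorem norm_frameConj_le {K : Matrix m n 𝕜} {ε : ℝ} (hP : ‖Kᴴ * K - 1‖ ≤ ε) (X : Matrix n n 𝕜) :
    ‖K * X * Kᴴ‖ ≤ (1 + ε) * ‖X‖ := by
  have hK2 : ‖K‖ * ‖K‖ ≤ 1 + ε := by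
    rw [← Matrix.l2_opNorm_conjTranspose_mul_self]; exact norm_le_one_add_of_norm_sub_one_le hP
  calc ‖K * X * Kᴴ‖ ≤ ‖K * X‖ * ‖Kᴴ‖ := Matrix.l2_opNorm_mul _ _
    _ ≤ ‖K‖ * ‖X‖ * ‖K‖ := by
        rw [Matrix.l2_opNorm_conjTranspose]
        exact mul_le_mul_of_nonneg_right (Matrix.l2_opNorm_mul _ _) (norm_nonneg _)
    _ = (‖K‖ * ‖K‖) * ‖X‖ := by ring
    _ ≤ (1 + ε) * ‖X‖ := mul_le_mul_of_nonneg_right hK2 (norm_nonneg _)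

omit [Fintype m] [DecidableEq m] in
/-- `‖(D P)^j D‖ ≤ ((1+ε)α)^j α` for `‖P − 1‖ ≤ ε`, `‖D‖ ≤ α`. [cite: Higham2008, §10.1] -/
theorem norm_pow_mul_le {P D : Matrix n n 𝕜} {ε α : ℝ} (hP : ‖P - 1‖ ≤ ε) (hD : ‖D‖ ≤ α) (j : ℕ) :
    ‖(D * P) ^ j * D‖ ≤ ((1 + ε) * α) ^ j * α := by
  have hα : 0 ≤ α := (norm_nonneg D).trans hD
  have hDP : ‖D * P‖ ≤ (1 + ε) * α :=
    calc ‖D * P‖ ≤ ‖D‖ * ‖P‖ := Matrix.l2_opNorm_mul _ _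
      _ ≤ α * (1 + ε) := mul_le_mul hD (norm_le_one_add_of_norm_sub_one_le hP) (norm_nonneg _) hα
      _ = (1 + ε) * α := mul_comm _ _
  calc ‖(D * P) ^ j * D‖ ≤ ‖(D * P) ^ j‖ * ‖D‖ := Matrix.l2_opNorm_mul _ _
    _ ≤ ‖D * P‖ ^ j * α := mul_le_mul (norm_pow_le_pow_norm _ j) hD (norm_nonneg _) (pow_nonneg (norm_nonneg _) _)
    _ ≤ ((1 + ε) * α) ^ j * α :=
        mul_le_mul_of_nonneg_right (pow_le_pow_left₀ (norm_nonneg _) hDP j) hα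

omit [Fintype m] [DecidableEq m] in
/-- **The termwise remainder**: `‖(D P)^j D − D^{j+1}‖ ≤ α(((1+ε)α)^j − α^j)` for `‖P − 1‖ ≤ ε` (`ε ≥ 0`),
`‖D‖ ≤ α` — by induction from `(D P)^{j+1} D − D^{j+2} = D[(P − 1)(D P)^j D + ((D P)^j D − D^{j+1})]`.
[cite: Higham2008, §10.1] -/
theorem norm_pow_mul_sub_pow_le {P D : Matrix n n 𝕜} {ε α : ℝ} (hε : 0 ≤ ε) (hP : ‖P - 1‖ ≤ ε)
    (hD : ‖D‖ ≤ α) : ∀ j : ℕ, ‖(D * P) ^ j * D - D ^ (j + 1)‖ ≤ α * (((1 + ε) * α) ^ j - α ^ j)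
  | 0 => by simp
  | j + 1 => by
    have ih := norm_pow_mul_sub_pow_le hε hP hD j
    have hα : 0 ≤ α := (norm_nonneg D).trans hD
    have e : (D * P) ^ (j + 1) * D - D ^ (j + 1 + 1) =
        D * ((P - 1) * ((D * P) ^ j * D) + ((D * P) ^ j * D - D ^ (j + 1))) := by
      rw [pow_succ' (D * P) j, pow_succ' D (j + 1)]
      simp only [Matrix.mul_add, Matrix.mul_sub, Matrix.sub_mul, Matrix.one_mul, Matrix.mul_assoc]
      abel
    rw [e]
    calc ‖D * ((P - 1) * ((D * P) ^ j * D) + ((D * P) ^ j * D - D ^ (j + 1)))‖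
        ≤ ‖D‖ * (‖P - 1‖ * ‖(D * P) ^ j * D‖ + ‖(D * P) ^ j * D - D ^ (j + 1)‖) :=
          (norm_mul_le _ _).trans (mul_le_mul_of_nonneg_left
            ((norm_add_le _ _).trans (add_le_add (norm_mul_le _ _) le_rfl)) (norm_nonneg _))
      _ ≤ α * (ε * (((1 + ε) * α) ^ j * α) + α * (((1 + ε) * α) ^ j - α ^ j)) := by
          refine mul_le_mul hD (add_le_add ?_ ih) (by positivity) hα
          exact mul_le_mul hP (norm_pow_mul_le hP hD j) (norm_nonneg _) hε
      _ = α * (((1 + ε) * α) ^ (j + 1) - α ^ (j + 1)) := by ring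

/-- **Remainder bound for a nearly orthonormal frame.** If `‖Kᴴ K − 1‖ ≤ ε` (`ε ≥ 0`) and `‖D‖ ≤ α` then
`‖exp (K D Kᴴ) − 1 − K (exp D − 1) Kᴴ‖ ≤ θ(α, ε) := e^{(1+ε)α} − (1+ε)e^{α} + ε`
(termwise on the exponential series: the `j`-th term of the left-hand side is `(j!)⁻¹ K((D·KᴴK)^{j−1}D − D^j)Kᴴ`,
of norm `≤ (j!)⁻¹(((1+ε)α)^j − (1+ε)α^j)` for `j ≥ 1`, `0` for `j = 0`). For an exact isometry (`ε = 0`) the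
bound is `0`. [cite: Higham2008, §10.1] -/
theorem norm_exp_frameConj_sub_le {K : Matrix m n 𝕜} {D : Matrix n n 𝕜} {ε α : ℝ} (hε : 0 ≤ ε)
    (hP : ‖Kᴴ * K - 1‖ ≤ ε) (hD : ‖D‖ ≤ α) :
    ‖exp (K * D * Kᴴ) - 1 - K * (exp D - 1) * Kᴴ‖ ≤ Real.exp ((1 + ε) * α) - (1 + ε) * Real.exp α + ε := by
  have hα : 0 ≤ α := (norm_nonneg D).trans hD
  have h1 : HasSum (fun j : ℕ => ((j ! : 𝕜)⁻¹) • (K * D * Kᴴ) ^ j) (exp (K * D * Kᴴ)) :=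
    exp_series_hasSum_exp' _
  have h3 : HasSum (fun j : ℕ => K * (((j ! : 𝕜)⁻¹) • D ^ j) * Kᴴ) (K * exp D * Kᴴ) :=
    hasSum_frameConj (exp_series_hasSum_exp' D) K
  have h4 : HasSum (fun j : ℕ => if j = 0 then (1 : Matrix m m 𝕜) - K * Kᴴ else 0) (1 - K * Kᴴ) :=
    hasSum_ite_eq 0 _
  have hE : HasSum (fun j : ℕ => ((j ! : 𝕜)⁻¹) • (K * D * Kᴴ) ^ j - K * (((j ! : 𝕜)⁻¹) • D ^ j) * Kᴴ -
      (if j = 0 then (1 : Matrix m m 𝕜) - K * Kᴴ else 0))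
      (exp (K * D * Kᴴ) - K * exp D * Kᴴ - (1 - K * Kᴴ)) := (h1.sub h3).sub h4
  -- the real majorant
  have hb : HasSum (fun j : ℕ => ((j ! : ℝ)⁻¹) * (((1 + ε) * α) ^ j - (1 + ε) * α ^ j) +
      (if j = 0 then ε else 0)) (Real.exp ((1 + ε) * α) - (1 + ε) * Real.exp α + ε) := by
    have e1 : HasSum (fun j : ℕ => ((1 + ε) * α) ^ j / (j ! : ℝ)) (Real.exp ((1 + ε) * α)) := by
      rw [Real.exp_eq_exp_ℝ]; exact expSeries_div_hasSum_exp _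
    have e2 : HasSum (fun j : ℕ => α ^ j / (j ! : ℝ)) (Real.exp α) := by
      rw [Real.exp_eq_exp_ℝ]; exact expSeries_div_hasSum_exp _
    have e3 : HasSum (fun j : ℕ => if j = 0 then ε else 0) ε := hasSum_ite_eq 0 ε
    have efun : (fun j : ℕ => ((j ! : ℝ)⁻¹) * (((1 + ε) * α) ^ j - (1 + ε) * α ^ j) +
        (if j = 0 then ε else 0)) = fun j => (((1 + ε) * α) ^ j / (j ! : ℝ) - (1 + ε) * (α ^ j / (j ! : ℝ))) +
        (if j = 0 then ε else 0) := by
      funext j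
      simp only [div_eq_inv_mul]
      ring
    rw [efun]
    exact (e1.sub (e2.mul_left (1 + ε))).add e3
  have hval : exp (K * D * Kᴴ) - 1 - K * (exp D - 1) * Kᴴ = exp (K * D * Kᴴ) - K * exp D * Kᴴ - (1 - K * Kᴴ) := by
    simp only [Matrix.mul_sub, Matrix.sub_mul, Matrix.mul_one]
    abel
  rw [hval]
  refine HasSum.norm_le_of_bounded hE hb fun j => ?_
  cases j with
  | zero => simp
  | succ j =>
    rw [if_neg (Nat.succ_ne_zero j), if_neg (Nat.succ_ne_zero j), sub_zero, add_zero, frameConj_pow_succ,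
      Matrix.mul_smul, Matrix.smul_mul, ← smul_sub, ← Matrix.sub_mul, ← Matrix.mul_sub, norm_smul]
    have hc : ‖((((j + 1)! : ℕ) : 𝕜))⁻¹‖ = ((((j + 1)! : ℕ) : ℝ))⁻¹ := by simp
    rw [hc]
    refine mul_le_mul_of_nonneg_left ?_ (inv_nonneg.2 (Nat.cast_nonneg _))
    calc ‖K * ((D * (Kᴴ * K)) ^ j * D - D ^ (j + 1)) * Kᴴ‖
        ≤ (1 + ε) * ‖(D * (Kᴴ * K)) ^ j * D - D ^ (j + 1)‖ := norm_frameConj_le hP _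
      _ ≤ (1 + ε) * (α * (((1 + ε) * α) ^ j - α ^ j)) :=
          mul_le_mul_of_nonneg_left (norm_pow_mul_sub_pow_le hε hP hD j) (by linarith)
      _ = ((1 + ε) * α) ^ (j + 1) - (1 + ε) * α ^ (j + 1) := by ring


end FrameExponential

end Literature.LinearAlgebra.Matrix

end
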